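import Summits.QuantumFields.YangMills.Theorems.ColdStartUniversalityLatticeLangevinMartingaleIncrements
import Summits.QuantumFields.YangMills.Theorems.ColdStartUniversalityLatticeLangevinTimeDecorrelation
import Summits.QuantumFields.YangMills.Theorems.ColdStartUniversalityLatticeLangevinLiebRobinsonMixingTime
import Summits.QuantumFields.YangMills.Theorems.ColdStartUniversalityLatticeLangevinCocycleMain
import HarnessLib

/-!
# Route `ColdStartUniversality` (fixed-cut-off SZZ dynamics): ★★★ VOLUME-FREE HOEFFDING INEQUALITY FOR DISCRETE SAMPLES OF LOCAL OBSERVABLES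
# AT STRONG COUPLING `|β'| < 1/12` — and the generic skeleton-chain Hoeffding bound from a pointwise mixing estimate

Helper file (seat `ym-line-csu-p1`, g34; `--supports stmt-QuantumFields-24809`).  File 71 (`measureReal_average_deviation_le_exp`) bounds the
deviation probabilities of the empirical means `N⁻¹Σ_(k<N) G(U_(kh))` of the cold-start Langevin sampler with the Harris constants `C, c` of
`exp_mixing_szz`, which depend on the volume.  Its proof only uses the every-start mixing OF THE SAMPLED OBSERVABLE; this file isolates that:
* ★★ `measureReal_average_deviation_le_exp_of_mixing_bound` — GENERIC: for every realising kernel family `κ`, every strong solution `U` from a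
  deterministic start on ANY space, every measurable `G` with `|G| ≤ 1` obeying a pointwise mixing bound `|κ_t G(y) − μ_(β')(G)| ≤ K e^(−γt)`
  (every `y`, `t`), every step `h > 0`, every `N` and `ε > 0`:
  `P[|N⁻¹ Σ_(k<N) G(U_(kh)) − μ_(β')(G)| ≥ ε] ≤ 2·exp(−Nε²/(32 g²))`, `g = max(1, K/(1 − e^(−γh)))`
  (finite-horizon Poisson sum + Chapman–Kolmogorov + Markov property + file 68, as in file 71);
* ★★★ `measureReal_average_deviation_le_exp_uniform_of_linkLipschitz` — at `|β'| < 1/12`, for every torus size `L`, every `C⁵` LOCAL observable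
  `f∘coords` with link-Lipschitz profile `ℓ ≥ 0` supported in `Λ` and `|f∘coords| ≤ 1` (plaquettes, Wilson loops after normalisation):
  `P[|N⁻¹ Σ_(k<N) f∘coords(U_(kh)) − μ_(β')(f∘coords)| ≥ ε] ≤ 2·exp(−Nε²/(32 g_f²))`, `g_f = max(1, C_f/(1 − e^(−ρh/2)))`,
  `C_f = 12π·#Λ·√(Σℓ²)·(6(7+6λ/ρ)³+2)`, `ρ = 1 − 12|β'|`, `λ = (1300+4√2)|β'|` — the constant does NOT depend on the volume
  (g29/g30's `wilson_local_mixing_halfRate_of_linkLipschitz`).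
[cite: GlynnOrmoneit2002, Theorem 2].  THEOREMS ONLY, no definition, no sorry.  HONEST FRAMING: fixed cut-off, fixed `|β'| < 1/12` (the route's
scaling `β'_K → ∞` leaves this window); `UniformColdStartMixing` (24809) is NOT restated; no crux, rung or summit statement is proved; the
Yang–Mills mass gap is NOT proved.
-/

set_option autoImplicit false

noncomputable section

namespace Summit.QuantumFields.YangMills.Theorems.ColdStartUniversality.LiebRobinson

open MeasureTheory ProbabilityTheory Filter Topology Set
open scoped NNReal ENNReal BigOperators
open Literature Literature.Probability.Process Literature.MathematicalPhysics.QuantumFieldTheory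
open Literature.MathematicalPhysics.QuantumFieldTheory.Balaban1983to89
open Literature.MathematicalPhysics.QuantumLattice (fundamentalRep fundamentalLatticeRep continuous_fundamentalRep fundamentalRep_apply)

variable {L : ℕ} [NeZero L]

/-! ## §1. Generic: Hoeffding for the `h`-skeleton from a pointwise mixing bound of the sampled observable -/

/-- ★★ **Hoeffding's inequality for discrete samples from a pointwise mixing bound.**  For every realising Markov kernel family `κ` of the SU(2)
SZZ dynamics, every strong solution `U` from a deterministic start on ANY probability space, every measurable `G` with `|G| ≤ 1` such that
`|∫ G dκ_t(y) − ∫ G dμ_(β')| ≤ K·e^(−γt)` for all `t, y` (`K ≥ 0`, `γ > 0`), every step `h > 0`, every `N` and every `ε > 0`: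
`P[ |N⁻¹ Σ_(k<N) G(U_(kh)) − ∫ G dμ_(β')| ≥ ε ] ≤ 2 · exp(−N·ε² / (32·g²))`, `g = max(1, K/(1 − e^(−γh)))`. [cite: GlynnOrmoneit2002, Theorem 2] -/
theorem measureReal_average_deviation_le_exp_of_mixing_bound (β' : ℝ)
    (κ : ℝ≥0 → Kernel (GaugeConfig 3 L (Matrix.specialUnitaryGroup (Fin 2) ℂ))
      (GaugeConfig 3 L (Matrix.specialUnitaryGroup (Fin 2) ℂ))) [∀ t, IsMarkovKernel (κ t)] (hκ0 : κ 0 = Kernel.id)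
    (hreal : ∀ (t : ℝ≥0) (x : GaugeConfig 3 L (Matrix.specialUnitaryGroup (Fin 2) ℂ))
        (Ω : Type) [MeasurableSpace Ω] (P : Measure Ω) [IsProbabilityMeasure P]
        (W : ℝ≥0 → Ω → (Edge 3 L × NoiseIdx 2 → ℝ)) (hW : IsFlatBrownian W P)
        (U : ℝ≥0 → Ω → GaugeConfig 3 L (Matrix.specialUnitaryGroup (Fin 2) ℂ)),
        (∀ ω, U 0 ω = x) →
        (latticeLangevinDynamics (fundamentalLatticeRep 2) β').IsSolution (fundamentalRep (Fin 2))
          hW.natFiltration P W U →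
        κ t x = P.map (U t))
    (x : GaugeConfig 3 L (Matrix.specialUnitaryGroup (Fin 2) ℂ))
    {Ω : Type} [MeasurableSpace Ω] {P : Measure Ω} [IsProbabilityMeasure P]
    {W : ℝ≥0 → Ω → (Edge 3 L × NoiseIdx 2 → ℝ)} (hW : IsFlatBrownian W P)
    {U : ℝ≥0 → Ω → GaugeConfig 3 L (Matrix.specialUnitaryGroup (Fin 2) ℂ)} (hU0 : ∀ ω, U 0 ω = x)
    (hU : (latticeLangevinDynamics (fundamentalLatticeRep 2) β').IsSolution (fundamentalRep (Fin 2)) hW.natFiltration P W U)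
    {G : GaugeConfig 3 L (Matrix.specialUnitaryGroup (Fin 2) ℂ) → ℝ} (hG : Measurable G) (hG1 : ∀ z, |G z| ≤ 1)
    {K γ : ℝ} (hK : 0 ≤ K) (hγ : 0 < γ)
    (hmixG : ∀ (t : ℝ≥0) (y : GaugeConfig 3 L (Matrix.specialUnitaryGroup (Fin 2) ℂ)),
      |(∫ z, G z ∂(κ t y)) - ∫ z, G z ∂(wilsonMeasure (d := 3) (L := L) (fundamentalRep (Fin 2)) β')| ≤ K * Real.exp (-γ * t))
    {h : ℝ≥0} (hh : 0 < h) (N : ℕ) {ε : ℝ} (hε : 0 < ε) :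
    P.real {ω | ε ≤ |(N : ℝ)⁻¹ * (∑ k ∈ Finset.range N, G (U ((k : ℝ≥0) * h) ω)) -
        ∫ z, G z ∂(wilsonMeasure (d := 3) (L := L) (fundamentalRep (Fin 2)) β')|} ≤
      2 * Real.exp (-(N * ε ^ 2) / (32 * max 1 (K / (1 - Real.exp (-γ * h))) ^ 2)) := by
  classical
  haveI := secondCountableTopology_su2
  haveI := borelSpace_config L
  haveI : IsProbabilityMeasure (wilsonMeasure (d := 3) (L := L) (fundamentalRep (Fin 2)) β') :=
    isProbabilityMeasure_wilsonMeasure (d := 3) (L := L) (fundamentalRep (Fin 2)) (continuous_fundamentalRep (Fin 2)) β'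
  set m : ℝ := ∫ z, G z ∂(wilsonMeasure (d := 3) (L := L) (fundamentalRep (Fin 2)) β') with hm
  have hm1 : |m| ≤ 1 := by
    have hh' := norm_integral_le_of_norm_le_const (μ := wilsonMeasure (d := 3) (L := L) (fundamentalRep (Fin 2)) β') (f := G) (C := 1)
      (Eventually.of_forall fun z => by simpa [Real.norm_eq_abs] using hG1 z)
    simpa [Real.norm_eq_abs] using hh'
  -- the constants `ρ = e^(−γh) ∈ (0,1)` and `g = max(1, K/(1−ρ))`
  set ρ : ℝ := Real.exp (-γ * h) with hρ
  have hρ0 : 0 < ρ := Real.exp_pos _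
  have hρ1 : ρ < 1 := Real.exp_lt_one_iff.2 (by have : (0 : ℝ) < h := hh; nlinarith)
  set g : ℝ := max 1 (K / (1 - Real.exp (-γ * h))) with hg
  have hg1 : 1 ≤ g := le_max_left _ _
  have hgC : K / (1 - ρ) ≤ g := le_max_right _ _
  have hg0 : 0 < g := one_pos.trans_le hg1
  have hmU : ∀ s : ℝ≥0, Measurable (U s) := fun s => (hU.adapted s).mono (hW.natFiltration.le s) le_rfl
  /- ### 0. Trivial regimes: `N = 0`, or `ε > 2` -/
  have hRHS1 : ∀ {y : ℝ}, y ≤ 3 / 8 → (1 : ℝ) ≤ 2 * Real.exp (-y) := fun {y} hy => by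
    have h1 := Real.add_one_le_exp (-y)
    linarith
  rcases Nat.eq_zero_or_pos N with hN0 | hNpos
  · subst hN0
    refine measureReal_le_one.trans ?_
    rw [Nat.cast_zero, zero_mul, neg_zero, zero_div, Real.exp_zero]
    norm_num
  have hNr : (0 : ℝ) < N := by exact_mod_cast hNpos
  have havg : ∀ ω, |(N : ℝ)⁻¹ * ∑ k ∈ Finset.range N, G (U ((k : ℝ≥0) * h) ω)| ≤ 1 := fun ω => by
    rw [abs_mul, abs_inv, abs_of_pos hNr]
    have h1 : |∑ k ∈ Finset.range N, G (U ((k : ℝ≥0) * h) ω)| ≤ N := (Finset.abs_sum_le_sum_abs _ _).trans (by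
      calc ∑ k ∈ Finset.range N, |G (U ((k : ℝ≥0) * h) ω)| ≤ ∑ _k ∈ Finset.range N, (1 : ℝ) := Finset.sum_le_sum fun k _ => hG1 _
        _ = N := by simp)
    calc (N : ℝ)⁻¹ * |∑ k ∈ Finset.range N, G (U ((k : ℝ≥0) * h) ω)| ≤ (N : ℝ)⁻¹ * N := mul_le_mul_of_nonneg_left h1 (inv_nonneg.2 hNr.le)
      _ = 1 := inv_mul_cancel₀ hNr.ne'
  by_cases hε2 : 2 < ε
  · have hempty : {ω | ε ≤ |(N : ℝ)⁻¹ * (∑ k ∈ Finset.range N, G (U ((k : ℝ≥0) * h) ω)) - m|} = ∅ := by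
      refine Set.eq_empty_iff_forall_notMem.2 fun ω hω => ?_
      simp only [Set.mem_setOf_eq] at hω
      have h3 : |(N : ℝ)⁻¹ * (∑ k ∈ Finset.range N, G (U ((k : ℝ≥0) * h) ω)) - m| ≤ 2 := (abs_sub _ _).trans (by linarith [havg ω, hm1])
      linarith
    rw [hempty, measureReal_empty]
    positivity
  push Not at hε2
  /- ### 1. Realising kernels, the centred observable, the kernel actions `a_j = κ_(jh) Ĝ` -/
  set Gh : GaugeConfig 3 L (Matrix.specialUnitaryGroup (Fin 2) ℂ) → ℝ := fun z => G z - m with hGh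
  have hGhm : Measurable Gh := hG.sub measurable_const
  have hGhb : ∀ z, |Gh z| ≤ 2 := fun z => (abs_sub _ _).trans (by linarith [hG1 z, hm1])
  set a : ℕ → GaugeConfig 3 L (Matrix.specialUnitaryGroup (Fin 2) ℂ) → ℝ := fun j y => ∫ z, Gh z ∂(κ ((j : ℝ≥0) * h) y) with ha
  have ham : ∀ j, Measurable (a j) := fun j => (hGhm.stronglyMeasurable.integral_kernel (κ := κ ((j : ℝ≥0) * h))).measurable
  have hGi : ∀ (ν : Measure (GaugeConfig 3 L (Matrix.specialUnitaryGroup (Fin 2) ℂ))) [IsProbabilityMeasure ν], Integrable G ν := fun ν _ =>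
    (integrable_const (1 : ℝ)).mono' hG.aestronglyMeasurable (Eventually.of_forall fun z => by simpa [Real.norm_eq_abs] using hG1 z)
  have ha_eq : ∀ j y, a j y = (∫ z, G z ∂(κ ((j : ℝ≥0) * h) y)) - m := fun j y => by
    simp only [ha, hGh]
    rw [integral_sub (hGi _) (integrable_const m), integral_const, smul_eq_mul, probReal_univ, one_mul]
  have hab : ∀ j y, |a j y| ≤ K * ρ ^ j := fun j y => by
    rw [ha_eq, hρ, ← Real.exp_nat_mul]
    have h1 := hmixG ((j : ℝ≥0) * h) y
    have h2 : -γ * (((j : ℝ≥0) * h : ℝ≥0) : ℝ) = j * (-γ * h) := by push_cast; ring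
    rwa [h2] at h1
  /- ### 2. The horizon `M` and the finite Poisson sum `ĝ_M = Σ_(j<M) a_j` -/
  obtain ⟨M, hM⟩ := exists_pow_lt_of_lt_one (show 0 < g / (N * K + 1) by positivity) hρ1
  have hMb : (N : ℝ) * (K * ρ ^ M) ≤ g := by
    have h1 : (N * K + 1) * ρ ^ M ≤ g := by
      have := (lt_div_iff₀ (by positivity : (0 : ℝ) < N * K + 1)).1 hM
      linarith [mul_comm (ρ ^ M) ((N : ℝ) * K + 1)]
    nlinarith [pow_nonneg hρ0.le M]
  set gM : GaugeConfig 3 L (Matrix.specialUnitaryGroup (Fin 2) ℂ) → ℝ := fun y => ∑ j ∈ Finset.range M, a j y with hgM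
  have hgMm : Measurable gM := Finset.measurable_sum _ fun j _ => ham j
  have hgeom : ∑ j ∈ Finset.range M, ρ ^ j ≤ 1 / (1 - ρ) := by
    rw [le_div_iff₀ (by linarith), geom_sum_mul_neg]
    linarith [pow_nonneg hρ0.le M]
  have hgMb : ∀ y, |gM y| ≤ g := fun y => by
    calc |gM y| ≤ ∑ j ∈ Finset.range M, |a j y| := Finset.abs_sum_le_sum_abs _ _
      _ ≤ ∑ j ∈ Finset.range M, K * ρ ^ j := Finset.sum_le_sum fun j _ => hab j y
      _ = K * ∑ j ∈ Finset.range M, ρ ^ j := by rw [Finset.mul_sum]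
      _ ≤ K * (1 / (1 - ρ)) := mul_le_mul_of_nonneg_left hgeom hK
      _ = K / (1 - ρ) := by ring
      _ ≤ g := hgC
  -- `κ_h ĝ_M = Σ_(j<M) a_(j+1)` (Chapman–Kolmogorov)
  have hai : ∀ j (ν : Measure (GaugeConfig 3 L (Matrix.specialUnitaryGroup (Fin 2) ℂ))) [IsProbabilityMeasure ν], Integrable (a j) ν :=
    fun j ν _ => (integrable_const (K * ρ ^ j)).mono' (ham j).aestronglyMeasurable
      (Eventually.of_forall fun z => by rw [Real.norm_eq_abs]; exact hab j z)
  have hκgM : ∀ y, ∫ z, gM z ∂(κ h y) = ∑ j ∈ Finset.range M, a (j + 1) y := by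
    intro y
    simp only [hgM]
    rw [integral_finsetSum _ fun j _ => hai j _]
    refine Finset.sum_congr rfl fun j _ => ?_
    have hck := chapmanKolmogorov_szz β' κ hreal h ((j : ℝ≥0) * h)
    have heq : (((j + 1 : ℕ) : ℝ≥0) * h) = h + (j : ℝ≥0) * h := by push_cast; ring
    have hGhi : Integrable Gh ((κ ((j : ℝ≥0) * h) ∘ₖ κ h) y) := by
      haveI : IsProbabilityMeasure ((κ ((j : ℝ≥0) * h) ∘ₖ κ h) y) := by rw [← hck]; infer_instance
      exact (integrable_const (2 : ℝ)).mono' hGhm.aestronglyMeasurable (Eventually.of_forall fun z => by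
        rw [Real.norm_eq_abs]; exact hGhb z)
    show ∫ z, a j z ∂(κ h y) = ∫ z, Gh z ∂(κ (((j + 1 : ℕ) : ℝ≥0) * h) y)
    rw [heq, hck, Kernel.integral_comp hGhi]
  -- the finite-horizon Poisson relation `ĝ_M − κ_h ĝ_M = Ĝ − a_M`
  have hPois : ∀ y, gM y - ∫ z, gM z ∂(κ h y) = Gh y - a M y := by
    intro y
    have ha0 : a 0 y = Gh y := by
      simp only [ha, Nat.cast_zero, zero_mul, hκ0, Kernel.id_apply]
      exact integral_dirac' _ _ hGhm.stronglyMeasurable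
    rw [hκgM, hgM, ← Finset.sum_sub_distrib, Finset.sum_range_sub', ha0]
  /- ### 3. The increments `D_k = ĝ_M(U_((k+1)h)) − (κ_h ĝ_M)(U_(kh))` -/
  have hκgMm : Measurable fun y => ∫ z, gM z ∂(κ h y) := (hgMm.stronglyMeasurable.integral_kernel (κ := κ h)).measurable
  have hκgMb : ∀ y, |∫ z, gM z ∂(κ h y)| ≤ g := fun y => by
    have hh' := norm_integral_le_of_norm_le_const (μ := κ h y) (f := gM) (C := g)
      (Eventually.of_forall fun z => by simpa [Real.norm_eq_abs] using hgMb z)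
    simpa [Real.norm_eq_abs] using hh'
  set D : ℕ → Ω → ℝ := fun k ω =>
    gM (U (((k + 1 : ℕ) : ℝ≥0) * h) ω) - ∫ z, gM z ∂(κ h (U ((k : ℝ≥0) * h) ω)) with hD
  have hkh : ∀ j k : ℕ, j ≤ k → (j : ℝ≥0) * h ≤ (k : ℝ≥0) * h := fun j k hjk =>
    mul_le_mul_of_nonneg_right (by exact_mod_cast hjk) h.2
  have hDF : ∀ k, Measurable[hW.natFiltration (((k + 1 : ℕ) : ℝ≥0) * h)] (D k) := fun k =>
    (hgMm.comp (hU.adapted _)).sub ((hκgMm.comp (hU.adapted _)).mono (hW.natFiltration.mono (hkh k (k + 1) (Nat.le_succ k))) le_rfl)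
  have hDm : ∀ k, Measurable (D k) := fun k => (hDF k).mono (hW.natFiltration.le _) le_rfl
  set B : ℝ := 2 * g with hB
  have hB0 : 0 < B := by positivity
  have hDb : ∀ k ω, |D k ω| ≤ B := fun k ω => by
    simp only [hD, hB]
    exact (abs_sub _ _).trans (by linarith [hgMb (U (((k + 1 : ℕ) : ℝ≥0) * h) ω), hκgMb (U ((k : ℝ≥0) * h) ω)])
  /- ### 4. Orthogonality (Markov property, file 44) -/
  have horth : ∀ k < N, ∀ l : ℝ, ∫ ω, Real.exp (l * ∑ j ∈ Finset.range k, D j ω) * D k ω ∂P = 0 := by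
    intro k _ l
    set Z : Ω → ℝ := fun ω => Real.exp (l * ∑ j ∈ Finset.range k, D j ω) with hZ
    have hSF : Measurable[hW.natFiltration ((k : ℝ≥0) * h)] fun ω => ∑ j ∈ Finset.range k, D j ω := by
      refine Finset.measurable_sum (Finset.range k) fun j hj => ?_
      exact (hDF j).mono (hW.natFiltration.mono (hkh (j + 1) k (Nat.succ_le_of_lt (Finset.mem_range.1 hj)))) le_rfl
    have hZF : Measurable[hW.natFiltration ((k : ℝ≥0) * h)] Z := (hSF.const_mul l).exp
    have hZm : Measurable Z := hZF.mono (hW.natFiltration.le _) le_rfl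
    have hSb : ∀ ω, |∑ j ∈ Finset.range k, D j ω| ≤ k * B := fun ω =>
      (Finset.abs_sum_le_sum_abs _ _).trans (by
        calc ∑ j ∈ Finset.range k, |D j ω| ≤ ∑ _j ∈ Finset.range k, B := Finset.sum_le_sum fun j _ => hDb j ω
          _ = k * B := by rw [Finset.sum_const, Finset.card_range, nsmul_eq_mul])
    have hZb : ∀ ω, |Z ω| ≤ Real.exp (|l| * (k * B)) := fun ω => by
      rw [hZ, abs_of_pos (Real.exp_pos _), Real.exp_le_exp]
      calc l * ∑ j ∈ Finset.range k, D j ω ≤ |l * ∑ j ∈ Finset.range k, D j ω| := le_abs_self _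
        _ = |l| * |∑ j ∈ Finset.range k, D j ω| := abs_mul _ _
        _ ≤ |l| * (k * B) := mul_le_mul_of_nonneg_left (hSb ω) (abs_nonneg l)
    have e1 : ∫ ω, Z ω * gM (U (((k + 1 : ℕ) : ℝ≥0) * h) ω) ∂P = ∫ ω, Z ω * (∫ z, gM z ∂(κ h (U ((k : ℝ≥0) * h) ω))) ∂P := by
      have ht : (((k + 1 : ℕ) : ℝ≥0) * h) = (k : ℝ≥0) * h + h := by push_cast; ring
      rw [ht]
      exact integral_mul_comp_add_eq_integral_mul_transition β' κ hreal x hW hU0 hU ((k : ℝ≥0) * h) h hZF hZb hgMm hgMb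
    have hInt : ∀ {φ : Ω → ℝ} {Cφ : ℝ}, Measurable φ → (∀ ω, |φ ω| ≤ Cφ) → Integrable (fun ω => Z ω * φ ω) P :=
      fun {φ Cφ} hφ hφb => (integrable_const (Real.exp (|l| * (k * B)) * Cφ)).mono' (hZm.mul hφ).aestronglyMeasurable
        (Eventually.of_forall fun ω => by
          rw [norm_mul, Real.norm_eq_abs, Real.norm_eq_abs]
          exact mul_le_mul (hZb ω) (hφb ω) (abs_nonneg _) (Real.exp_pos _).le)
    have i1 : Integrable (fun ω => Z ω * gM (U (((k + 1 : ℕ) : ℝ≥0) * h) ω)) P := hInt (hgMm.comp (hmU _)) fun ω => hgMb _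
    have i2 : Integrable (fun ω => Z ω * ∫ z, gM z ∂(κ h (U ((k : ℝ≥0) * h) ω))) P := hInt (hκgMm.comp (hmU _)) fun ω => hκgMb _
    have hpt : ∀ ω, Z ω * D k ω = Z ω * gM (U (((k + 1 : ℕ) : ℝ≥0) * h) ω) - Z ω * ∫ z, gM z ∂(κ h (U ((k : ℝ≥0) * h) ω)) :=
      fun ω => by simp only [hD]; ring
    rw [integral_congr_ae (ae_of_all _ hpt), integral_sub i1 i2, e1, sub_self]
  /- ### 5. Azuma–Hoeffding (file 68), telescoping, event inclusion -/
  have htail : ∀ {r : ℝ}, 0 ≤ r → P.real {ω | r ≤ |∑ j ∈ Finset.range N, D j ω|} ≤ 2 * Real.exp (-r ^ 2 / (2 * (N * B ^ 2))) :=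
    fun {r} hr => measureReal_abs_sum_ge_le_of_orthogonal D hDm hB0 hDb N horth hr
  have hsum : ∀ ω, ∑ j ∈ Finset.range N, D j ω = gM (U ((N : ℝ≥0) * h) ω) - gM (U (((0 : ℕ) : ℝ≥0) * h) ω) +
      ((∑ j ∈ Finset.range N, Gh (U ((j : ℝ≥0) * h) ω)) - ∑ j ∈ Finset.range N, a M (U ((j : ℝ≥0) * h) ω)) := by
    intro ω
    have h1 : ∀ j, D j ω = (gM (U (((j + 1 : ℕ) : ℝ≥0) * h) ω) - gM (U ((j : ℝ≥0) * h) ω)) +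
        (gM (U ((j : ℝ≥0) * h) ω) - ∫ z, gM z ∂(κ h (U ((j : ℝ≥0) * h) ω))) := fun j => by simp only [hD]; ring
    rw [Finset.sum_congr rfl fun j _ => h1 j, Finset.sum_add_distrib,
      Finset.sum_range_sub (fun j => gM (U ((j : ℝ≥0) * h) ω)) N]
    congr 1
    exact (Finset.sum_congr rfl fun j _ => hPois _).trans
      (Finset.sum_sub_distrib (fun j : ℕ => Gh (U ((j : ℝ≥0) * h) ω)) (fun j : ℕ => a M (U ((j : ℝ≥0) * h) ω)))
  have hU0' : ∀ ω, U (((0 : ℕ) : ℝ≥0) * h) ω = x := fun ω => by rw [Nat.cast_zero, zero_mul]; exact hU0 ω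
  have hcent : ∀ ω, (N : ℝ)⁻¹ * (∑ k ∈ Finset.range N, G (U ((k : ℝ≥0) * h) ω)) - m =
      (N : ℝ)⁻¹ * ∑ k ∈ Finset.range N, Gh (U ((k : ℝ≥0) * h) ω) := fun ω => by
    simp only [hGh, Finset.sum_sub_distrib, Finset.sum_const, Finset.card_range, nsmul_eq_mul, mul_sub]
    rw [← mul_assoc, inv_mul_cancel₀ hNr.ne', one_mul]
  have hrem : ∀ ω, |∑ j ∈ Finset.range N, a M (U ((j : ℝ≥0) * h) ω)| ≤ g := fun ω =>
    (Finset.abs_sum_le_sum_abs _ _).trans ((Finset.sum_le_sum fun j _ => hab M _).trans (by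
      rw [Finset.sum_const, Finset.card_range, nsmul_eq_mul]; exact hMb))
  have hincl : {ω | ε ≤ |(N : ℝ)⁻¹ * (∑ k ∈ Finset.range N, G (U ((k : ℝ≥0) * h) ω)) - m|} ⊆
      {ω | N * ε - 3 * g ≤ |∑ j ∈ Finset.range N, D j ω|} := by
    intro ω hω
    simp only [Set.mem_setOf_eq] at hω ⊢
    rw [hcent ω, abs_mul, abs_inv, abs_of_pos hNr] at hω
    have hNI : (N : ℝ) * ε ≤ |∑ k ∈ Finset.range N, Gh (U ((k : ℝ≥0) * h) ω)| := by
      have := mul_le_mul_of_nonneg_left hω hNr.le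
      rwa [← mul_assoc, mul_inv_cancel₀ hNr.ne', one_mul] at this
    have hI : ∑ k ∈ Finset.range N, Gh (U ((k : ℝ≥0) * h) ω) = (∑ j ∈ Finset.range N, D j ω) -
        (gM (U ((N : ℝ≥0) * h) ω) - gM (U (((0 : ℕ) : ℝ≥0) * h) ω)) + ∑ j ∈ Finset.range N, a M (U ((j : ℝ≥0) * h) ω) := by
      rw [hsum ω]; ring
    rw [hI] at hNI
    have h1 := abs_add_le ((∑ j ∈ Finset.range N, D j ω) - (gM (U ((N : ℝ≥0) * h) ω) - gM (U (((0 : ℕ) : ℝ≥0) * h) ω)))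
      (∑ j ∈ Finset.range N, a M (U ((j : ℝ≥0) * h) ω))
    have h2 := abs_sub (∑ j ∈ Finset.range N, D j ω) (gM (U ((N : ℝ≥0) * h) ω) - gM (U (((0 : ℕ) : ℝ≥0) * h) ω))
    have h3 : |gM (U ((N : ℝ≥0) * h) ω) - gM (U (((0 : ℕ) : ℝ≥0) * h) ω)| ≤ 2 * g :=
      (abs_sub _ _).trans (by linarith [hgMb (U ((N : ℝ≥0) * h) ω), hgMb (U (((0 : ℕ) : ℝ≥0) * h) ω)])
    linarith [hrem ω]
  /- ### 6. Arithmetic -/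
  by_cases hbig : 6 * g ≤ N * ε
  · have hr : 0 ≤ N * ε - 3 * g := by linarith
    refine (measureReal_mono hincl).trans ((htail hr).trans ?_)
    refine mul_le_mul_of_nonneg_left (Real.exp_le_exp.2 ?_) (by norm_num)
    rw [neg_div, neg_div, neg_le_neg_iff]
    have hden0 : 0 < 2 * (N * B ^ 2) := by positivity
    have hnum : (N : ℝ) ^ 2 * ε ^ 2 / 4 ≤ (N * ε - 3 * g) ^ 2 := by nlinarith
    calc (N : ℝ) * ε ^ 2 / (32 * g ^ 2) = ((N : ℝ) ^ 2 * ε ^ 2 / 4) / (2 * (N * B ^ 2)) := by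
          rw [hB, div_eq_div_iff (by positivity) (by positivity)]
          ring
      _ ≤ (N * ε - 3 * g) ^ 2 / (2 * (N * B ^ 2)) := div_le_div_of_nonneg_right hnum hden0.le
  · push Not at hbig
    have hNε2 : (N : ℝ) * ε ^ 2 < 12 * g := by
      calc (N : ℝ) * ε ^ 2 = (N * ε) * ε := by ring
        _ ≤ (N * ε) * 2 := by gcongr
        _ < (6 * g) * 2 := by gcongr
        _ = 12 * g := by ring
    refine measureReal_le_one.trans ?_
    rw [neg_div]
    refine hRHS1 ?_
    rw [div_le_div_iff₀ (by positivity) (by norm_num)]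
    nlinarith


/-! ## §2. Local observables at `|β'| < 1/12`: the volume-free bound -/

/-- ★★★ **VOLUME-FREE HOEFFDING INEQUALITY for discrete samples of local observables at strong coupling.**  At `|β'| < 1/12`, for every torus
size `L`, every strong solution `U` of the SU(2) SZZ dynamics from a deterministic start on ANY probability space (e.g. the cold start), every
`C⁵` local observable `f` with link-Lipschitz profile `ℓ ≥ 0` supported in `Λ` and `|f∘coords| ≤ 1`, every step `h > 0`, every `N`, `ε > 0`:
`P[ |N⁻¹ Σ_(k<N) f∘coords(U_(kh)) − μ_(β')(f∘coords)| ≥ ε ] ≤ 2 · exp(−N·ε² / (32·g_f²))` with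
`g_f = max(1, C_f/(1 − e^(−ρh/2)))`, `C_f = 12π·#Λ·√(Σℓ²)·(6(7+6λ/ρ)³+2)`, `ρ = 1 − 12|β'|`, `λ = (1300+4√2)|β'|` — INDEPENDENT OF THE VOLUME.
[cite: GlynnOrmoneit2002, Theorem 2] -/
theorem measureReal_average_deviation_le_exp_uniform_of_linkLipschitz (L : ℕ) [NeZero L] (β' : ℝ) (hβ : |β'| < 1 / 12)
    (x : GaugeConfig 3 L (Matrix.specialUnitaryGroup (Fin 2) ℂ))
    {Ω : Type} [MeasurableSpace Ω] {P : Measure Ω} [IsProbabilityMeasure P]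
    {W : ℝ≥0 → Ω → (Edge 3 L × NoiseIdx 2 → ℝ)} (hW : IsFlatBrownian W P)
    {U : ℝ≥0 → Ω → GaugeConfig 3 L (Matrix.specialUnitaryGroup (Fin 2) ℂ)} (hU0 : ∀ ω, U 0 ω = x)
    (hU : (latticeLangevinDynamics (fundamentalLatticeRep 2) β').IsSolution (fundamentalRep (Fin 2)) hW.natFiltration P W U)
    {f : (Edge 3 L × Fin 2 × Fin 2 × Bool → ℝ) → ℝ} (hf : ContDiff ℝ 5 f) (Λ : Finset (Edge 3 L)) {ℓ : Edge 3 L → ℝ} (hℓ : ∀ e, 0 ≤ ℓ e)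
    (hℓΛ : ∀ e, e ∉ Λ → ℓ e = 0) {h : ℝ≥0} (hh : 0 < h) (N : ℕ) {ε : ℝ} (hε : 0 < ε) :
    let coords : GaugeConfig 3 L (Matrix.specialUnitaryGroup (Fin 2) ℂ) → (Edge 3 L × Fin 2 × Fin 2 × Bool → ℝ) :=
      fun V q => (fun z : ℂ => if q.2.2.2 then z.im else z.re)
        ((fundamentalRep (Fin 2) (V q.1) : Matrix (Fin 2) (Fin 2) ℂ) q.2.1 q.2.2.1)
    (∀ (e : Edge 3 L) (y y' : (GaugeConfig 3 L (Matrix.specialUnitaryGroup (Fin 2) ℂ))), (∀ g, g ≠ e → y g = y' g) →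
      |f (coords y) - f (coords y')| ≤ ℓ e * frobNorm ((y e : Matrix (Fin 2) (Fin 2) ℂ) - (y' e : Matrix (Fin 2) (Fin 2) ℂ))) →
    (∀ y, |f (coords y)| ≤ 1) →
    P.real {ω | ε ≤ |(N : ℝ)⁻¹ * (∑ k ∈ Finset.range N, f (coords (U ((k : ℝ≥0) * h) ω))) -
        ∫ y, f (coords y) ∂(wilsonMeasure (d := 3) (L := L) (fundamentalRep (Fin 2)) β')|} ≤
      2 * Real.exp (-(N * ε ^ 2) / (32 * max 1
        ((12 * Real.pi * Λ.card * Real.sqrt (∑ e : Edge 3 L, ℓ e ^ 2) * (6 * (7 + 6 * ((1300 + 4 * Real.sqrt 2) * |β'|) / (1 - 12 * |β'|)) ^ 3 + 2)) /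
          (1 - Real.exp (-((1 - 12 * |β'|) / 2) * h))) ^ 2)) := by
  intro coords hLip hf1
  classical
  haveI := secondCountableTopology_su2
  haveI := borelSpace_config L
  obtain ⟨κ, hκM, hκ0, hreal⟩ := exists_transitionKernel L β'
  haveI := hκM
  have hco : Continuous coords := continuous_coords (L := L)
  have hGm : Measurable fun y : (GaugeConfig 3 L (Matrix.specialUnitaryGroup (Fin 2) ℂ)) => f (coords y) :=
    (hf.continuous.comp hco).measurable
  have hρ : 0 < (1 - 12 * |β'|) / 2 := by linarith
  have hK : 0 ≤ 12 * Real.pi * Λ.card * Real.sqrt (∑ e : Edge 3 L, ℓ e ^ 2) *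
      (6 * (7 + 6 * ((1300 + 4 * Real.sqrt 2) * |β'|) / (1 - 12 * |β'|)) ^ 3 + 2) := by
    have : 0 < 1 - 12 * |β'| := by linarith
    positivity
  have hmixG : ∀ (t : ℝ≥0) (y : GaugeConfig 3 L (Matrix.specialUnitaryGroup (Fin 2) ℂ)),
      |(∫ z, f (coords z) ∂(κ t y)) - ∫ z, f (coords z) ∂(wilsonMeasure (d := 3) (L := L) (fundamentalRep (Fin 2)) β')| ≤
        12 * Real.pi * Λ.card * Real.sqrt (∑ e : Edge 3 L, ℓ e ^ 2) * (6 * (7 + 6 * ((1300 + 4 * Real.sqrt 2) * |β'|) / (1 - 12 * |β'|)) ^ 3 + 2) *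
          Real.exp (-((1 - 12 * |β'|) / 2) * t) := fun t y => by
    have h1 := wilson_local_mixing_halfRate_of_linkLipschitz L β' hβ κ hreal hf Λ hℓ hℓΛ t hLip y
    rwa [neg_mul]
  exact measureReal_average_deviation_le_exp_of_mixing_bound β' κ hκ0 hreal x hW hU0 hU hGm hf1 hK hρ hmixG hh N hε

end Summit.QuantumFields.YangMills.Theorems.ColdStartUniversality.LiebRobinson

end
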